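import Summits.QuantumFields.BalabanUV.Beta.GAN24.DressedLegSeamLowerBound

/-!
# `BalabanUV.Beta.GAN24.TripleWardReadout` — binder row G-an2-4 ∕ (CONV-C), W-slot CT-W, route «WC-TL» ∕ (Q-R) «QR-LL», rows (LT) ∕ (DIV) ∕ (DL):
# **THE TRIPLE WARD READ-OUT** — the three coarse codifferentials (slot `divV`, kernel row `codiff₁`, kernel column `codiff₁`) of a three-leg push
# `push₃ l r w S` read out ALL THREE legs EXACTLY through their coarse Ward laws: `δ_col δ_row divV (push₃ l r w S) = c_w·c_l·c_r · push₃ Γ_l Γ_r Γ_w S`;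
# for the literal's dressed chain `T = legChain (respStepBmSeq ρ Lc) m k` (all three legs, `c = (Lc^{(d+1)(k+1)})⁻¹`, `Γ = gaugeWt (Lc^(k+1))` the
# block-indicator gauge) hypothesis-free: the transported letter's triple zero-mode component is `c³ ×` THE LETTER PUSHED ON THREE GAUGE-WEIGHT LEGS —
# a leg-free, transport-free object of the born letter (G-an2-4 formalisation swarm → CRUX TEAM (2), leaf prover `b2b-balaban-gan24-formalise-leaf-03`,
# gen 64, PART 1; the companion PART 2 `TripleFaceCharge` turns the END's displayed layer bound into a bound on this object)

NOT IN PRINT; OUR BOOKKEEPING ([folklore] linearity of leaf-01's `Push3.push₃` in EACH leg family on the summable class (`Push3LegTelescope.push₃_sub_right ∕ _add_right ∕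
_smul_right ∕ _sub_table ∕ _add_table ∕ _smul_table`), the entry formula `Push3.push₃_inl_inl`, `Push4.vertexW_apply`; leaf-01 g69's ROW law
`PushRowCoarseWard.codiff₁_push₃_row_eq_smul_of_ward` BY NAME; the chain's coarse Ward law `PushRowCoarseWardChain.sum_legChain_sub_eq_gaugeWt` + `Push4Iter.legDecay_legChain` +
`RespStepBmDecomp.legDecay_respStepBm_levels` + leaf-03 g41's `RespStepBmDecompPsi.legDecay_respStep_levels_holds` (levelwise leg decay, hypothesis-free), leaf-01 g69's
`DressedLegSeamLowerBound.abs_gaugeWt_le_one` (the one import: ROW-WARD PART 3, which carries PARTs 1∕2); an2∕an5's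
`AveragingWardStencils.b6UnitVec_eq`; generic `d`; 0 `def`, 0 cited facts, 0 `def … : Prop`, 0 sorry).  HONEST FRAMING (cell contract, verbatim): «discharging `BetaPertH`
makes Bałaban's UV stability UNCONDITIONAL — a real constructive-QFT result; it is NOT the continuum limit and NOT the Clay problem.»  HONEST DEPENDENCY (verbatim): «continuum
YM on T⁴ ⇐ BetaPertH ∧ nine spine estimates (0/9 proved); BetaPertH ⇐ (D1) ∧ (D4) ∧ CAP+tail; G-an2-4 gates asym, D1 and NE2/3/4.»

## Why
The (DIV)∕(DL) record (the OWNER gan24-p1 g30∕g31: RULING R-gan24p1-g31-1 + A1, `gen31/ALT3-COST.md` (F2); leaf-01 g69 `DressedLegSeamLowerBound`) locates the W-slot's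
divergence at `d = 3` in the SLOWEST MODES of the dressed transport: block-constant gauges pass a dressed leg with the factor `c = L^{−(d+1)}` EXACTLY (the coarse Ward law),
while the END `WardRemainderEndThreeCoDress(Three)` asks the transported sub-letter `L^{3(d+1)}·push₃ T T T S` to decay like `K·θ^{k+1}`.  leaf-01's ROW-WARD reads out
ONE leg (the kernel row).  THIS FILE reads out ALL THREE: the kernel column (§1, the mirror of leaf-01's §1–§2 on the right leg) and the coarse SLOT (§2, on the table leg),
then composes (§3): the triple coarse codifferential of the push is the push of the letter on the three Ward data — for the chain, `c³ × push₃ Γ Γ Γ S` with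
`Γ = gaugeWt L` the gradient of the block indicator.  That object involves NO leg and NO transport: it reads the born letter's three indices against the boundaries of three
`L`-blocks (PART 2: a bound on every entry of the transported letter is a bound on it, the `L`-powers cancelling EXACTLY); and the table read alone is
the BLOCK SUM OF THE SLOT DIVERGENCE sandwiched by the kernel legs (`vertexW Γ S = Σ_{B_L(U)} divV S`) — so the triple read-out VANISHES on letters co-closed in the
slot (row (CC)'s good letters) and bites only on the flux-carrying (bad) ones.

## What (generic `d`; leg families `l r w : Fin (d+1) → Site → Fin (d+1) → Site → ℝ`; `S` a stencil family, `LocStencil S Cs δ`, `0 < δ`)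
* §1 **`push₃_col_eq_of_slice_eq`**, **`push₃_finset_sum_right`**, **`codiff₁_push₃_col_eq`**, **`codiff₁_push₃_col_eq_smul_of_ward`** — the `(z′, inl β)` COLUMN of the
  push reads only the slice `r β z′`; under a displayed coarse Ward law of the RIGHT leg `Σ_β (r β (z − e_β) κ u − r β z κ u) = c·g z κ u` the column codifferential is
  `c·push₃ l (fun _ ↦ g) w S κ′ u′ x′ z a (inl β₀)`.
* §2 **`push₃_slot_eq_of_slice_eq`**, **`push₃_finset_sum_table`**, **`divV_push₃_eq`**, **`divV_push₃_eq_smul_of_ward`** — the coarse SLOT `(κ′, u′)` of the push reads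
  only the slice `w κ′ u′`; under a coarse Ward law of the TABLE leg an2's slot divergence is `divV (push₃ l r w S) U = c • push₃ l r (fun _ ↦ g) S κ₀ U`.
* §3 **`codiff₁_codiff₁_divV_push₃_eq`** — THE TRIPLE READ-OUT for three Ward-covariant legs; **`codiff₁_codiff₁_divV_push₃_chain_eq`** — the literal's chain, all
  three legs `T = legChain (respStepBmSeq (toSite rr) Lc) m k`, HYPOTHESIS-FREE (in-block root, `LocStencil S Cs δ`, `δ > 0`):
  `codiff₁ (β z′ ↦ codiff₁ (α x ↦ divV (push₃ T T T S) U x z′ (inl α) (inl β)) y) z = c·(c·(c·push₃ Γ Γ Γ S κ₀ U y z (inl α₀) (inl β₀)))`,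
  `c = (Lc^{(d+1)(k+1)})⁻¹`, `Γ = fun _ ↦ gaugeWt (Lc^(k+1))`.
(PART 2 `TripleFaceCharge`: the table read in closed form `vertexW Γ S κ₀ U = Σ_{B_L(U)} divV S` — zero on co-closed letters — and the END's layer bound read
through §3b.)
Identities only: NO size of any cell is asserted, NO power of `Lc` claimed; decides nothing about (Q-R) ∕ (DIV) ∕ (DL) ∕ K-LL-4′ by itself (PART 2 draws the located
consequence); NOTHING of (LT) ∕ (LAY) ∕ (S) ∕ «T2Shape» discharged; 0 wall binders; NEVER «G-an2-4 closed» as (CONV-C); NOT D1, NOT `BetaPertH`, NOT continuum, NOT Clay;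
not in print — our bookkeeping.  2026-08-23; no existing file touched.
-/

noncomputable section

open Finset
open scoped BigOperators
open Literature.MathematicalPhysics.QuantumFieldTheory
open Literature.MathematicalPhysics.QuantumFieldTheory.Balaban1983to89
open Literature.MathematicalPhysics.QuantumFieldTheory.Balaban1983to89.Beta
open ExpKernelCalculus (MKer Decays)
open AffineAveraging (Form0 Form1 box toSite dz codiff₁ blockSum)
open AveragingContours (blk)
open OneStepResolventKernel (Fib LocStencil)
open KernelWard (divV)
open BalabanCompositeJets (respStep summable_slice_of_locStencil)
open Summit.QuantumFields.BalabanUV.Beta.KernelWardRelative (gaugeWt)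
open Summit.QuantumFields.BalabanUV.Beta.GAN24.Push4 (vertexW vertexW_apply)
open Summit.QuantumFields.BalabanUV.Beta.GAN24.Push4Bounds (LegDecay LegDecay.abs_le LegDecay.summable)
open Summit.QuantumFields.BalabanUV.Beta.GAN24.Push4Iter (LegFam legChain legDecay_legChain)
open Summit.QuantumFields.BalabanUV.Beta.GAN24.Push3 (push₃ push₃_def push₃_inl_inl push₃_inr_left push₃_inr_right)
open Summit.QuantumFields.BalabanUV.Beta.GAN24.Push3LegTelescope (push₃_sub_right push₃_add_right push₃_smul_right push₃_sub_table push₃_add_table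
  push₃_smul_table)
open Summit.QuantumFields.BalabanUV.Beta.GAN24.PushRowCoarseWard (codiff₁_push₃_row_eq_smul_of_ward)
open Summit.QuantumFields.BalabanUV.Beta.GAN24.PushRowCoarseWardChain (sum_legChain_sub_eq_gaugeWt)
open Summit.QuantumFields.BalabanUV.Beta.GAN24.RespStepBm (respStepBm)
open Summit.QuantumFields.BalabanUV.Beta.GAN24.RespStepBmDecomp (legDecay_respStepBm_levels)
open Summit.QuantumFields.BalabanUV.Beta.GAN24.RespStepBmDecompExact (respStepBmSeq respStepBmSeq_apply)
open Summit.QuantumFields.BalabanUV.Beta.GAN24.RespStepBmDecompPsi (legDecay_respStep_levels_holds)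
open Summit.QuantumFields.BalabanUV.Beta.GAN24.DressedLegSeamLowerBound (abs_gaugeWt_le_one)

namespace Summit.QuantumFields.BalabanUV.Beta.GAN24.TripleWardReadout

variable {d : ℕ}

/-! ## §1 The column read-out: the `(z′, inl β)` column of the push reads only the slice `r β z′` of the RIGHT leg -/

section Column

variable (l r r₂ w : Fin (d + 1) → (Fin (d + 1) → ℤ) → Fin (d + 1) → (Fin (d + 1) → ℤ) → ℝ)
  (S : Fin (d + 1) → (Fin (d + 1) → ℤ) → MKer (d + 1) (Fib d))

/-- [folklore] **THE `(z′, inl β)` COLUMN OF THE PUSH READS ONLY THE SLICE `r β z′` OF THE RIGHT LEG** (the entry formula `Push3.push₃_inl_inl`; multiplier rows vanish):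
two right leg families with the same slice at `(β, z′)` resp. `(β₂, z₂)` give the same column, whatever the other slices. -/
theorem push₃_col_eq_of_slice_eq {β β₂ : Fin (d + 1)} {z' z₂ : Fin (d + 1) → ℤ} (h : r β z' = r₂ β₂ z₂)
    (κ' : Fin (d + 1)) (u' x' : Fin (d + 1) → ℤ) (a : Fib d) :
    push₃ l r w S κ' u' x' z' a (Sum.inl β) = push₃ l r₂ w S κ' u' x' z₂ a (Sum.inl β₂) := by
  rcases a with α | μ
  · rw [push₃_inl_inl, push₃_inl_inl]
    refine tsum_congr fun z => Finset.sum_congr rfl fun κ₂ _ => ?_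
    rw [h]
  · rw [push₃_inr_left, push₃_inr_left]

variable {l r w S}

/-- [folklore] **`push₃` IS FINITELY ADDITIVE IN THE RIGHT LEG FAMILY ON THE SUMMABLE CLASS**: left legs BOUNDED, right legs with SUMMABLE fine columns, table legs BOUNDED,
table `LocStencil S Cs δ` (`0 < δ`) ⟹ `push₃ l (Σ_{i∈s} R i) w S κ′ u′ = Σ_{i∈s} push₃ l (R i) w S κ′ u′` (induction on `Push3LegTelescope.push₃_add_right`). -/
theorem push₃_finset_sum_right {ι : Type*} (s : Finset ι)
    (R : ι → Fin (d + 1) → (Fin (d + 1) → ℤ) → Fin (d + 1) → (Fin (d + 1) → ℤ) → ℝ) {Cl Cw Cs δ : ℝ}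
    (hl : ∀ α x' κ x, |l α x' κ x| ≤ Cl) (hRs : ∀ i β z' κ, Summable fun z => R i β z' κ z)
    (hw : ∀ κ' u' κ u, |w κ' u' κ u| ≤ Cw) (hS : LocStencil S Cs δ) (hδ : 0 < δ)
    (κ' : Fin (d + 1)) (u' : Fin (d + 1) → ℤ) :
    push₃ l (∑ i ∈ s, R i) w S κ' u' = ∑ i ∈ s, push₃ l (R i) w S κ' u' := by
  classical
  induction s using Finset.induction_on with
  | empty =>
    rw [Finset.sum_empty, Finset.sum_empty]
    have h := push₃_smul_right l (0 : Fin (d + 1) → (Fin (d + 1) → ℤ) → Fin (d + 1) → (Fin (d + 1) → ℤ) → ℝ) w S (0 : ℝ) κ' u'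
    rwa [zero_smul, zero_smul] at h
  | insert a s ha ih =>
    have hsums : ∀ β z' κ, Summable fun z => (∑ i ∈ s, R i) β z' κ z := fun β z' κ =>
      (summable_sum (s := s) fun i _ => hRs i β z' κ).congr fun z => by simp only [Finset.sum_apply]
    rw [Finset.sum_insert ha, Finset.sum_insert ha, push₃_add_right hl (hRs a) hsums hw hS hδ κ' u', ih]

variable {Cl Cw Cs δ : ℝ}

/-- NOT IN PRINT; OUR BOOKKEEPING.  **THE COARSE COLUMN CODIFFERENTIAL OF THE THREE-LEG PUSH** (summable class: left legs BOUNDED, right legs with SUMMABLE fine columns,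
table legs BOUNDED, `LocStencil S Cs δ`, `0 < δ`): for every coarse slot `(κ′, u′)`, row `(x′, a)`, column block `z` and any direction `β₀`,
`codiff₁ (β z′ ↦ push₃ l r w S κ′ u′ x′ z′ a (inl β)) z = push₃ l (fun _ z′ κ u ↦ Σ_β (r β (z′ − e_β) κ u − r β z′ κ u)) w S κ′ u′ x′ z a (inl β₀)`
— the column enters only through the right leg (first lemma), the `2(d+1)` columns are frozen slices, and `push₃` is additive in them. -/
theorem codiff₁_push₃_col_eq (hl : ∀ α x' κ x, |l α x' κ x| ≤ Cl) (hrs : ∀ β z' κ, Summable fun z => r β z' κ z)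
    (hw : ∀ κ' u' κ u, |w κ' u' κ u| ≤ Cw) (hS : LocStencil S Cs δ) (hδ : 0 < δ)
    (κ' : Fin (d + 1)) (u' x' z : Fin (d + 1) → ℤ) (a : Fib d) (β₀ : Fin (d + 1)) :
    codiff₁ (fun β z' => push₃ l r w S κ' u' x' z' a (Sum.inl β)) z
      = push₃ l (fun _ z' κ u => ∑ β, (r β (z' - AffineAveraging.unitVec β) κ u - r β z' κ u)) w S κ' u' x' z a (Sum.inl β₀) := by
  -- the frozen difference slices, as direction- and site-constant leg families
  set D : Fin (d + 1) → (Fin (d + 1) → (Fin (d + 1) → ℤ) → Fin (d + 1) → (Fin (d + 1) → ℤ) → ℝ) :=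
    fun β _ _ κ u => r β (z - AffineAveraging.unitVec β) κ u - r β z κ u with hD
  have hterm : ∀ β, push₃ l r w S κ' u' x' (z - AffineAveraging.unitVec β) a (Sum.inl β) - push₃ l r w S κ' u' x' z a (Sum.inl β)
      = push₃ l (D β) w S κ' u' x' z a (Sum.inl β₀) := by
    intro β
    have e1 : push₃ l r w S κ' u' x' (z - AffineAveraging.unitVec β) a (Sum.inl β)
        = push₃ l (fun _ _ => r β (z - AffineAveraging.unitVec β)) w S κ' u' x' z a (Sum.inl β₀) :=
      push₃_col_eq_of_slice_eq l r (fun _ _ => r β (z - AffineAveraging.unitVec β)) w S rfl κ' u' x' a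
    have e2 : push₃ l r w S κ' u' x' z a (Sum.inl β) = push₃ l (fun _ _ => r β z) w S κ' u' x' z a (Sum.inl β₀) :=
      push₃_col_eq_of_slice_eq l r (fun _ _ => r β z) w S rfl κ' u' x' a
    have e3 : D β = (fun _ _ => r β (z - AffineAveraging.unitVec β)) - (fun _ _ => r β z) := by
      funext β' x κ u; simp only [hD, Pi.sub_apply]
    rw [e1, e2, e3, push₃_sub_right hl (fun _ _ κ => hrs β _ κ) (fun _ _ κ => hrs β z κ) hw hS hδ κ' u']
    simp only [Pi.sub_apply]
  have hDs : ∀ β β' x κ, Summable fun u => D β β' x κ u := fun β β' x κ =>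
    ((hrs β (z - AffineAveraging.unitVec β) κ).sub (hrs β z κ)).congr fun u => by simp only [hD]
  calc codiff₁ (fun β z' => push₃ l r w S κ' u' x' z' a (Sum.inl β)) z
      = ∑ β, push₃ l (D β) w S κ' u' x' z a (Sum.inl β₀) := by
        simp only [AffineAveraging.codiff₁]
        exact Finset.sum_congr rfl fun β _ => hterm β
    _ = (∑ β, push₃ l (D β) w S κ' u') x' z a (Sum.inl β₀) := by simp only [Finset.sum_apply]
    _ = push₃ l (∑ β, D β) w S κ' u' x' z a (Sum.inl β₀) := by
        rw [push₃_finset_sum_right Finset.univ D hl hDs hw hS hδ κ' u']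
    _ = push₃ l (fun _ z' κ u => ∑ β, (r β (z' - AffineAveraging.unitVec β) κ u - r β z' κ u)) w S κ' u' x' z a (Sum.inl β₀) :=
        push₃_col_eq_of_slice_eq l _ _ w S (by funext κ u; simp only [hD, Finset.sum_apply]) κ' u' x' a

/-- NOT IN PRINT; OUR BOOKKEEPING.  **UNDER A DISPLAYED COARSE WARD LAW OF THE RIGHT LEG THE COLUMN CODIFFERENTIAL IS `c ×` THE PUSH WITH THE WARD DATUM AS RIGHT LEG**:
if `Σ_β (r β (z − e_β) κ u − r β z κ u) = c·g z κ u` for all `z κ u`, then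
`codiff₁ (β z′ ↦ push₃ l r w S κ′ u′ x′ z′ a (inl β)) z = c·push₃ l (fun _ ↦ g) w S κ′ u′ x′ z a (inl β₀)`. -/
theorem codiff₁_push₃_col_eq_smul_of_ward (hl : ∀ α x' κ x, |l α x' κ x| ≤ Cl) (hrs : ∀ β z' κ, Summable fun z => r β z' κ z)
    (hw : ∀ κ' u' κ u, |w κ' u' κ u| ≤ Cw) (hS : LocStencil S Cs δ) (hδ : 0 < δ)
    (g : (Fin (d + 1) → ℤ) → Fin (d + 1) → (Fin (d + 1) → ℤ) → ℝ) (c : ℝ)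
    (hW : ∀ z κ u, ∑ β, (r β (z - AffineAveraging.unitVec β) κ u - r β z κ u) = c * g z κ u)
    (κ' : Fin (d + 1)) (u' x' z : Fin (d + 1) → ℤ) (a : Fib d) (β₀ : Fin (d + 1)) :
    codiff₁ (fun β z' => push₃ l r w S κ' u' x' z' a (Sum.inl β)) z
      = c * push₃ l (fun _ => g) w S κ' u' x' z a (Sum.inl β₀) := by
  rw [codiff₁_push₃_col_eq hl hrs hw hS hδ κ' u' x' z a β₀]
  have e : (fun (_ : Fin (d + 1)) (z' : Fin (d + 1) → ℤ) (κ : Fin (d + 1)) (u : Fin (d + 1) → ℤ) =>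
      ∑ β, (r β (z' - AffineAveraging.unitVec β) κ u - r β z' κ u))
      = c • (fun (_ : Fin (d + 1)) => g) := by
    funext β z' κ u
    simp only [Pi.smul_apply, smul_eq_mul]
    exact hW z' κ u
  rw [e, push₃_smul_right, Pi.smul_apply, Pi.smul_apply, Pi.smul_apply, Pi.smul_apply, smul_eq_mul]

end Column

/-! ## §2 The slot read-out: the coarse slot `(κ′, u′)` of the push reads only the slice `w κ′ u′` of the TABLE leg -/

section Slot

variable (l r w w₂ : Fin (d + 1) → (Fin (d + 1) → ℤ) → Fin (d + 1) → (Fin (d + 1) → ℤ) → ℝ)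
  (S : Fin (d + 1) → (Fin (d + 1) → ℤ) → MKer (d + 1) (Fib d))

/-- [folklore] **THE COARSE SLOT OF THE PUSH READS ONLY THE SLICE `w κ′ u′` OF THE TABLE LEG** (`Push4.vertexW_apply`): two table leg families with the same slice at
`(κ′, u′)` resp. `(κ₂, u₂)` give the same pushed kernel. -/
theorem push₃_slot_eq_of_slice_eq {κ' κ₂ : Fin (d + 1)} {u' u₂ : Fin (d + 1) → ℤ} (h : w κ' u' = w₂ κ₂ u₂) :
    push₃ l r w S κ' u' = push₃ l r w₂ S κ₂ u₂ := by
  have hv : vertexW w S κ' u' = vertexW w₂ S κ₂ u₂ := by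
    funext x z a b
    rw [vertexW_apply, vertexW_apply, h]
  rw [push₃_def, push₃_def, hv]

variable {l r w S} {Cl Cw Cs δ : ℝ}

/-- [folklore] **`push₃` IS FINITELY ADDITIVE IN THE TABLE LEG FAMILY ON THE SUMMABLE CLASS**: left legs BOUNDED with SUMMABLE fine rows, right legs with SUMMABLE fine
columns, table legs uniformly BOUNDED, `LocStencil S Cs δ` (`0 < δ`) ⟹ `push₃ l r (Σ_{i∈s} W i) S κ′ u′ = Σ_{i∈s} push₃ l r (W i) S κ′ u′`
(induction on `Push3LegTelescope.push₃_add_table`). -/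
theorem push₃_finset_sum_table {ι : Type*} (s : Finset ι)
    (W : ι → Fin (d + 1) → (Fin (d + 1) → ℤ) → Fin (d + 1) → (Fin (d + 1) → ℤ) → ℝ) {C : ℝ}
    (hl : ∀ α x' κ x, |l α x' κ x| ≤ Cl) (hls : ∀ α x' κ, Summable fun x => l α x' κ x)
    (hrs : ∀ β z' κ, Summable fun z => r β z' κ z) (hW : ∀ i κ' u' κ u, |W i κ' u' κ u| ≤ C) (hS : LocStencil S Cs δ) (hδ : 0 < δ)
    (κ' : Fin (d + 1)) (u' : Fin (d + 1) → ℤ) :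
    push₃ l r (∑ i ∈ s, W i) S κ' u' = ∑ i ∈ s, push₃ l r (W i) S κ' u' := by
  classical
  induction s using Finset.induction_on with
  | empty =>
    rw [Finset.sum_empty, Finset.sum_empty]
    have h := push₃_smul_table l r (0 : Fin (d + 1) → (Fin (d + 1) → ℤ) → Fin (d + 1) → (Fin (d + 1) → ℤ) → ℝ) S (0 : ℝ) κ' u'
    rwa [zero_smul, zero_smul] at h
  | insert a s ha ih =>
    have hsum : ∀ κ₁ u₁ κ u, |(∑ i ∈ s, W i) κ₁ u₁ κ u| ≤ s.card * C := fun κ₁ u₁ κ u => by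
      simp only [Finset.sum_apply]
      refine (Finset.abs_sum_le_sum_abs _ _).trans ?_
      have h := Finset.sum_le_card_nsmul s (fun i => |W i κ₁ u₁ κ u|) C (fun i _ => hW i κ₁ u₁ κ u)
      rwa [nsmul_eq_mul] at h
    rw [Finset.sum_insert ha, Finset.sum_insert ha, push₃_add_table hl hls hrs (hW a) hsum hS hδ κ' u', ih]

/-- NOT IN PRINT; OUR BOOKKEEPING.  **an2's COARSE SLOT DIVERGENCE OF THE THREE-LEG PUSH** (summable class: left legs BOUNDED with SUMMABLE fine rows, right legs with SUMMABLE
fine columns, table legs BOUNDED, `LocStencil S Cs δ`, `0 < δ`): for every coarse site `U` and any direction `κ₀`,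
`divV (push₃ l r w S) U = push₃ l r (fun _ U′ κ u ↦ Σ_ν (w ν (U′ − e_ν) κ u − w ν U′ κ u)) S κ₀ U`
— the slot enters only through the table leg's slice, the `2(d+1)` slots are frozen slices, and `push₃` is additive in them. -/
theorem divV_push₃_eq (hl : ∀ α x' κ x, |l α x' κ x| ≤ Cl) (hls : ∀ α x' κ, Summable fun x => l α x' κ x)
    (hrs : ∀ β z' κ, Summable fun z => r β z' κ z) (hw : ∀ κ' u' κ u, |w κ' u' κ u| ≤ Cw) (hS : LocStencil S Cs δ) (hδ : 0 < δ)
    (κ₀ : Fin (d + 1)) (U : Fin (d + 1) → ℤ) :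
    divV (push₃ l r w S) U = push₃ l r (fun _ U' κ u => ∑ ν, (w ν (U' - AffineAveraging.unitVec ν) κ u - w ν U' κ u)) S κ₀ U := by
  set D : Fin (d + 1) → (Fin (d + 1) → (Fin (d + 1) → ℤ) → Fin (d + 1) → (Fin (d + 1) → ℤ) → ℝ) :=
    fun ν _ _ κ u => w ν (U - AffineAveraging.unitVec ν) κ u - w ν U κ u with hD
  have hterm : ∀ ν, push₃ l r w S ν (U - AffineAveraging.unitVec ν) - push₃ l r w S ν U = push₃ l r (D ν) S κ₀ U := by
    intro ν
    have e1 : push₃ l r w S ν (U - AffineAveraging.unitVec ν) = push₃ l r (fun _ _ => w ν (U - AffineAveraging.unitVec ν)) S κ₀ U :=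
      push₃_slot_eq_of_slice_eq l r w (fun _ _ => w ν (U - AffineAveraging.unitVec ν)) S rfl
    have e2 : push₃ l r w S ν U = push₃ l r (fun _ _ => w ν U) S κ₀ U :=
      push₃_slot_eq_of_slice_eq l r w (fun _ _ => w ν U) S rfl
    have e3 : D ν = (fun _ _ => w ν (U - AffineAveraging.unitVec ν)) - (fun _ _ => w ν U) := by
      funext ν' x κ u; simp only [hD, Pi.sub_apply]
    rw [e1, e2, e3, push₃_sub_table hl hls hrs (fun _ _ κ u => hw ν _ κ u) (fun _ _ κ u => hw ν U κ u) hS hδ κ₀ U]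
  have hCw : 0 ≤ Cw := (abs_nonneg _).trans (hw 0 0 0 0)
  have hDb : ∀ ν ν' x κ u, |D ν ν' x κ u| ≤ Cw + Cw := fun ν ν' x κ u => by
    simp only [hD]
    exact (abs_sub _ _).trans (add_le_add (hw _ _ _ _) (hw _ _ _ _))
  calc divV (push₃ l r w S) U
      = ∑ ν, push₃ l r (D ν) S κ₀ U := by
        simp only [KernelWard.divV, AveragingWardStencils.b6UnitVec_eq]
        exact Finset.sum_congr rfl fun ν _ => hterm ν
    _ = push₃ l r (∑ ν, D ν) S κ₀ U := by
        rw [push₃_finset_sum_table Finset.univ D hl hls hrs hDb hS hδ κ₀ U]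
    _ = push₃ l r (fun _ U' κ u => ∑ ν, (w ν (U' - AffineAveraging.unitVec ν) κ u - w ν U' κ u)) S κ₀ U :=
        push₃_slot_eq_of_slice_eq l r _ _ S (by funext κ u; simp only [hD, Finset.sum_apply])

/-- NOT IN PRINT; OUR BOOKKEEPING.  **UNDER A DISPLAYED COARSE WARD LAW OF THE TABLE LEG THE SLOT DIVERGENCE IS `c •` THE PUSH WITH THE WARD DATUM AS TABLE LEG**:
if `Σ_ν (w ν (U − e_ν) κ u − w ν U κ u) = c·g U κ u` for all `U κ u`, then `divV (push₃ l r w S) U = c • push₃ l r (fun _ ↦ g) S κ₀ U`. -/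
theorem divV_push₃_eq_smul_of_ward (hl : ∀ α x' κ x, |l α x' κ x| ≤ Cl) (hls : ∀ α x' κ, Summable fun x => l α x' κ x)
    (hrs : ∀ β z' κ, Summable fun z => r β z' κ z) (hw : ∀ κ' u' κ u, |w κ' u' κ u| ≤ Cw) (hS : LocStencil S Cs δ) (hδ : 0 < δ)
    (g : (Fin (d + 1) → ℤ) → Fin (d + 1) → (Fin (d + 1) → ℤ) → ℝ) (c : ℝ)
    (hW : ∀ U κ u, ∑ ν, (w ν (U - AffineAveraging.unitVec ν) κ u - w ν U κ u) = c * g U κ u)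
    (κ₀ : Fin (d + 1)) (U : Fin (d + 1) → ℤ) :
    divV (push₃ l r w S) U = c • push₃ l r (fun _ => g) S κ₀ U := by
  rw [divV_push₃_eq hl hls hrs hw hS hδ κ₀ U]
  have e : (fun (_ : Fin (d + 1)) (U' : Fin (d + 1) → ℤ) (κ : Fin (d + 1)) (u : Fin (d + 1) → ℤ) =>
      ∑ ν, (w ν (U' - AffineAveraging.unitVec ν) κ u - w ν U' κ u))
      = c • (fun (_ : Fin (d + 1)) => g) := by
    funext ν U' κ u
    simp only [Pi.smul_apply, smul_eq_mul]
    exact hW U' κ u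
  rw [e, push₃_smul_table]

end Slot

/-! ## §3 THE TRIPLE READ-OUT -/

section Triple

variable {l r w : Fin (d + 1) → (Fin (d + 1) → ℤ) → Fin (d + 1) → (Fin (d + 1) → ℤ) → ℝ}
  {S : Fin (d + 1) → (Fin (d + 1) → ℤ) → MKer (d + 1) (Fib d)} {Cl Cw Cs δ Cgl Cgw : ℝ}

/-- [folklore] `codiff₁` is homogeneous: `codiff₁ (α x ↦ c·A α x) y = c·codiff₁ A y`. -/
theorem codiff₁_const_mul (c : ℝ) (A : Fin (d + 1) → (Fin (d + 1) → ℤ) → ℝ) (y : Fin (d + 1) → ℤ) :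
    codiff₁ (fun α x => c * A α x) y = c * codiff₁ A y := by
  simp only [AffineAveraging.codiff₁, Finset.mul_sum, mul_sub]

/-- NOT IN PRINT; OUR BOOKKEEPING.  **THE TRIPLE WARD READ-OUT** (summable class: `l` BOUNDED with SUMMABLE fine rows, `r` with SUMMABLE fine columns, `w` BOUNDED,
`LocStencil S Cs δ`, `0 < δ`; the three legs obey DISPLAYED coarse Ward laws with data `(c_l, g_l)`, `(c_r, g_r)`, `(c_w, g_w)`, the data `g_l`, `g_w` BOUNDED): for every
coarse slot block `U`, row block `y`, column block `z` and directions `κ₀ α₀ β₀`,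
`codiff₁ (β z′ ↦ codiff₁ (α x ↦ divV (push₃ l r w S) U x z′ (inl α) (inl β)) y) z = c_w·(c_l·(c_r·push₃ (fun _ ↦ g_l) (fun _ ↦ g_r) (fun _ ↦ g_w) S κ₀ U y z (inl α₀) (inl β₀)))`
— slot (§2), then row (leaf-01's `codiff₁_push₃_row_eq_smul_of_ward`), then column (§1): each coarse codifferential trades one leg for its Ward datum. -/
theorem codiff₁_codiff₁_divV_push₃_eq (hl : ∀ α x' κ x, |l α x' κ x| ≤ Cl) (hls : ∀ α x' κ, Summable fun x => l α x' κ x)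
    (hrs : ∀ β z' κ, Summable fun z => r β z' κ z) (hw : ∀ κ' u' κ u, |w κ' u' κ u| ≤ Cw) (hS : LocStencil S Cs δ) (hδ : 0 < δ)
    {gl gr gw : (Fin (d + 1) → ℤ) → Fin (d + 1) → (Fin (d + 1) → ℤ) → ℝ} {cl cr cw : ℝ}
    (hgl : ∀ x κ u, |gl x κ u| ≤ Cgl) (hgw : ∀ U κ u, |gw U κ u| ≤ Cgw)
    (hWl : ∀ x κ u, ∑ α, (l α (x - AffineAveraging.unitVec α) κ u - l α x κ u) = cl * gl x κ u)
    (hWr : ∀ z κ u, ∑ β, (r β (z - AffineAveraging.unitVec β) κ u - r β z κ u) = cr * gr z κ u)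
    (hWw : ∀ U κ u, ∑ ν, (w ν (U - AffineAveraging.unitVec ν) κ u - w ν U κ u) = cw * gw U κ u)
    (κ₀ : Fin (d + 1)) (U y z : Fin (d + 1) → ℤ) (α₀ β₀ : Fin (d + 1)) :
    codiff₁ (fun β z' => codiff₁ (fun α x => divV (push₃ l r w S) U x z' (Sum.inl α) (Sum.inl β)) y) z
      = cw * (cl * (cr * push₃ (fun _ => gl) (fun _ => gr) (fun _ => gw) S κ₀ U y z (Sum.inl α₀) (Sum.inl β₀))) := by
  -- slot
  have h1 := divV_push₃_eq_smul_of_ward hl hls hrs hw hS hδ gw cw hWw κ₀ U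
  -- row, on `push₃ l r Γ_w S`
  have h2 : ∀ z', codiff₁ (fun α x => push₃ l r (fun _ => gw) S κ₀ U x z' (Sum.inl α) (Sum.inl β₀)) y
      = cl * push₃ (fun _ => gl) r (fun _ => gw) S κ₀ U y z' (Sum.inl α₀) (Sum.inl β₀) := fun z' =>
    codiff₁_push₃_row_eq_smul_of_ward hl hls hrs (fun _ U' κ u => hgw U' κ u) hS hδ gl cl hWl κ₀ U y z' α₀ (Sum.inl β₀)
  -- the inner function, rewritten
  have e : (fun β z' => codiff₁ (fun α x => divV (push₃ l r w S) U x z' (Sum.inl α) (Sum.inl β)) y)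
      = fun β z' => cw * (cl * push₃ (fun _ => gl) r (fun _ => gw) S κ₀ U y z' (Sum.inl α₀) (Sum.inl β)) := by
    funext β z'
    have e1 : (fun α x => divV (push₃ l r w S) U x z' (Sum.inl α) (Sum.inl β))
        = fun α x => cw * push₃ l r (fun _ => gw) S κ₀ U x z' (Sum.inl α) (Sum.inl β) := by
      funext α x
      rw [h1, Pi.smul_apply, Pi.smul_apply, Pi.smul_apply, Pi.smul_apply, smul_eq_mul]
    rw [e1, codiff₁_const_mul]
    -- the row read-out with the column direction `β` displayed: re-base `β₀ ↦ β` through the slice lemma is not needed — apply the row law at `b = inl β`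
    rw [codiff₁_push₃_row_eq_smul_of_ward hl hls hrs (fun _ U' κ u => hgw U' κ u) hS hδ gl cl hWl κ₀ U y z' α₀ (Sum.inl β)]
  rw [e]
  have e2 : (fun β z' => cw * (cl * push₃ (fun _ => gl) r (fun _ => gw) S κ₀ U y z' (Sum.inl α₀) (Sum.inl β)))
      = fun β z' => (cw * cl) * push₃ (fun _ => gl) r (fun _ => gw) S κ₀ U y z' (Sum.inl α₀) (Sum.inl β) := by
    funext β z'; ring
  rw [e2, codiff₁_const_mul,
    codiff₁_push₃_col_eq_smul_of_ward (fun _ x' κ x => hgl x' κ x) hrs (fun _ U' κ u => hgw U' κ u) hS hδ gr cr hWr κ₀ U y z (Sum.inl α₀) β₀]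
  ring

end Triple

/-! ## §3b The literal's dressed chain: all three legs `T = legChain (respStepBmSeq ρ Lc) m k`, hypothesis-free -/

section Chain

variable {Lc : ℕ} [NeZero Lc] {rr : Fin (d + 1) → ℕ}
  {S : Fin (d + 1) → (Fin (d + 1) → ℤ) → MKer (d + 1) (Fib d)} {Cs δ : ℝ}

/-- [folklore] **THE CHAIN LEGS ARE IN THE SUMMABLE CLASS, HYPOTHESIS-FREE**: `∃ C m > 0, LegDecay (legChain (respStepBmSeq (toSite rr) Lc) m k) (Lc^(k+1)) C m`
(`Push4Iter.legDecay_legChain` over `RespStepBm.legDecay_respStepBm_levels` with leaf-03 g41's `legDecay_respStep_levels_holds`). -/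
theorem exists_legDecay_legChain (hrr : rr ∈ box (d + 1) Lc) (m k : ℕ) :
    ∃ C mT : ℝ, 0 < mT ∧ LegDecay (legChain (respStepBmSeq (toSite rr) Lc) m k) (Lc ^ (k + 1)) C mT := by
  have hLc : 1 ≤ Lc := Nat.one_le_iff_ne_zero.2 (NeZero.ne Lc)
  have hseq : respStepBmSeq (d := d) (toSite rr) Lc = fun j => respStepBm (toSite rr) Lc (Lc ^ j) (Lc ^ (j + 1)) := by
    funext j; exact respStepBmSeq_apply (toSite rr) j
  have hDb : ∀ j, ∃ C m : ℝ, 0 < m ∧ LegDecay (respStepBmSeq (d := d) (toSite rr) Lc j) Lc C m := fun j => by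
    rw [hseq]; exact legDecay_respStepBm_levels hLc hrr legDecay_respStep_levels_holds j
  exact legDecay_legChain hDb m k

/-- NOT IN PRINT; OUR BOOKKEEPING.  **THE TRIPLE WARD READ-OUT OF THE DEPTH-`k` TRANSPORTED LETTER, HYPOTHESIS-FREE**: for every in-block root `toSite rr`, base level `m`,
depth `k`, `LocStencil S Cs δ` (`δ > 0`), coarse blocks `U y z` and directions `κ₀ α₀ β₀`, with `T = legChain (respStepBmSeq (toSite rr) Lc) m k` on all three legs,
`c = (Lc^{(d+1)(k+1)})⁻¹` and `Γ = fun _ ↦ gaugeWt (Lc^(k+1))` (the gradient of the composite-block indicator):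
`codiff₁ (β z′ ↦ codiff₁ (α x ↦ divV (push₃ T T T S) U x z′ (inl α) (inl β)) y) z = c·(c·(c·push₃ Γ Γ Γ S κ₀ U y z (inl α₀) (inl β₀)))`
— the transported letter's component along the three block-constant gauge modes is `c³ ×` THE BORN LETTER PUSHED ON THREE GAUGE-WEIGHT LEGS (no leg, no transport, no
resolvent left: PART 2's object). -/
theorem codiff₁_codiff₁_divV_push₃_chain_eq (hrr : rr ∈ box (d + 1) Lc) (m k : ℕ) (hS : LocStencil S Cs δ) (hδ : 0 < δ)
    (κ₀ : Fin (d + 1)) (U y z : Fin (d + 1) → ℤ) (α₀ β₀ : Fin (d + 1)) :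
    codiff₁ (fun β z' => codiff₁ (fun α x => divV (push₃ (legChain (respStepBmSeq (toSite rr) Lc) m k) (legChain (respStepBmSeq (toSite rr) Lc) m k)
        (legChain (respStepBmSeq (toSite rr) Lc) m k) S) U x z' (Sum.inl α) (Sum.inl β)) y) z
      = (((Lc : ℝ) ^ ((d + 1) * (k + 1)))⁻¹) * ((((Lc : ℝ) ^ ((d + 1) * (k + 1)))⁻¹) * ((((Lc : ℝ) ^ ((d + 1) * (k + 1)))⁻¹)
          * push₃ (fun _ => gaugeWt (Lc ^ (k + 1))) (fun _ => gaugeWt (Lc ^ (k + 1))) (fun _ => gaugeWt (Lc ^ (k + 1))) S κ₀ U y z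
              (Sum.inl α₀) (Sum.inl β₀))) := by
  obtain ⟨CT, mT, hmT, hT⟩ := exists_legDecay_legChain hrr m k
  exact codiff₁_codiff₁_divV_push₃_eq (fun α x' κ x => hT.abs_le hmT.le α x' κ x) (fun α x' κ => hT.summable hmT α x' κ)
    (fun β z' κ => hT.summable hmT β z' κ) (fun κ' u' κ u => hT.abs_le hmT.le κ' u' κ u) hS hδ
    (fun x κ u => abs_gaugeWt_le_one _ x κ u) (fun U' κ u => abs_gaugeWt_le_one _ U' κ u)
    (sum_legChain_sub_eq_gaugeWt hrr m k) (sum_legChain_sub_eq_gaugeWt hrr m k) (sum_legChain_sub_eq_gaugeWt hrr m k) κ₀ U y z α₀ β₀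

end Chain

end Summit.QuantumFields.BalabanUV.Beta.GAN24.TripleWardReadout

end
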